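import Mathlib

/-!
# The small-ball lemma of card `binomial-extremal-dart-game` — kernel-checked

`dartGameSmallBall` : for a finitely supported law `w` on values `X i ∈ [0,1]` with mean
`p = ∑ w i * X i`, the `k`-fold i.i.d. sum satisfies
`P[∑ X < 1] ≤ 2 (1-p)^k + k p (1-p)^(k-1)`.
Proof: Hoeffding–Bentkus binomial extremality in convex order (`Ssum_le_bernoulli`) tested on the
hockey stick `x ↦ max (2 - x) 0`.
-/

namespace Summit.PneNP.PneNP.Cruxes.NoStableSection.SketchIdeator1

open Finset

variable {N : ℕ}

/-- `E[φ(X_{ω 0} + ⋯ + X_{ω (k-1)})]` under the `k`-fold product of the law `w`. -/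
noncomputable def Ssum (k : ℕ) (w X : Fin N → ℝ) (φ : ℝ → ℝ) : ℝ :=
  ∑ ω : Fin k → Fin N, (∏ r, w (ω r)) * φ (∑ r, X (ω r))

theorem Ssum_zero (w X : Fin N → ℝ) (φ : ℝ → ℝ) : Ssum 0 w X φ = φ 0 := by
  simp [Ssum]

theorem Ssum_succ (k : ℕ) (w X : Fin N → ℝ) (φ : ℝ → ℝ) :
    Ssum (k + 1) w X φ = ∑ i : Fin N, w i * Ssum k w X (fun s => φ (X i + s)) := by
  unfold Ssum
  rw [← (Fin.consEquiv fun _ => Fin N).sum_comp, Fintype.sum_prod_type]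
  refine Finset.sum_congr rfl fun i _ => ?_
  rw [Finset.mul_sum]
  refine Finset.sum_congr rfl fun ω _ => ?_
  simp only [Fin.consEquiv, Equiv.coe_fn_mk, Fin.prod_univ_succ, Fin.sum_univ_succ, Fin.cons_zero,
    Fin.cons_succ]
  ring

theorem Ssum_mono {k : ℕ} {w X : Fin N → ℝ} (hw : ∀ i, 0 ≤ w i) {f g : ℝ → ℝ}
    (h : ∀ ω : Fin k → Fin N, f (∑ r, X (ω r)) ≤ g (∑ r, X (ω r))) :
    Ssum k w X f ≤ Ssum k w X g := by
  unfold Ssum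
  exact Finset.sum_le_sum fun ω _ =>
    mul_le_mul_of_nonneg_left (h ω) (Finset.prod_nonneg fun r _ => hw _)

theorem Ssum_congr {k : ℕ} {w X : Fin N → ℝ} {f g : ℝ → ℝ}
    (h : ∀ ω : Fin k → Fin N, f (∑ r, X (ω r)) = g (∑ r, X (ω r))) :
    Ssum k w X f = Ssum k w X g := by
  unfold Ssum
  exact Finset.sum_congr rfl fun ω _ => by rw [h ω]

theorem Ssum_add {k : ℕ} (w X : Fin N → ℝ) (f g : ℝ → ℝ) :
    Ssum k w X (fun s => f s + g s) = Ssum k w X f + Ssum k w X g := by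
  simp [Ssum, mul_add, Finset.sum_add_distrib]

theorem Ssum_smul {k : ℕ} (w X : Fin N → ℝ) (a : ℝ) (f : ℝ → ℝ) :
    Ssum k w X (fun s => a * f s) = a * Ssum k w X f := by
  simp [Ssum, Finset.mul_sum, mul_left_comm]

theorem Ssum_finset_sum {k : ℕ} {ι : Type*} (t : Finset ι) (w X : Fin N → ℝ) (g : ι → ℝ → ℝ) :
    Ssum k w X (fun s => ∑ i ∈ t, g i s) = ∑ i ∈ t, Ssum k w X (g i) := by
  classical
  induction t using Finset.induction_on with
  | empty => simp [Ssum]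
  | insert a t ha ih =>
    rw [Finset.sum_insert ha, ← ih, ← Ssum_add]
    exact Ssum_congr fun ω => by rw [Finset.sum_insert ha]

/-- The chord inequality: a convex function lies below its chord over `[c, c+1]`. -/
theorem chord {φ : ℝ → ℝ} (hφ : ConvexOn ℝ Set.univ φ) {x : ℝ} (hx0 : 0 ≤ x) (hx1 : x ≤ 1)
    (c : ℝ) : φ (x + c) ≤ (1 - x) * φ c + x * φ (1 + c) := by
  have h := hφ.2 (Set.mem_univ c) (Set.mem_univ (1 + c)) (sub_nonneg.2 hx1) hx0 (by ring)
  have heq : (1 - x) • c + x • (1 + c) = x + c := by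
    simp only [smul_eq_mul]; ring
  rw [heq] at h
  simpa [smul_eq_mul] using h

/-- The Bernoulli law on `Fin 2`: weight `1-p` on the value `0`, weight `p` on the value `1`. -/
noncomputable def bw (p : ℝ) : Fin 2 → ℝ := ![1 - p, p]
/-- Values of the Bernoulli law. -/
noncomputable def bX : Fin 2 → ℝ := ![0, 1]

theorem Ssum_bernoulli_succ (k : ℕ) (p : ℝ) (φ : ℝ → ℝ) :
    Ssum (k + 1) (bw p) bX φ = (1 - p) * Ssum k (bw p) bX φ + p * Ssum k (bw p) bX (fun s => φ (1 + s)) := by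
  rw [Ssum_succ, Fin.sum_univ_two]
  simp [bw, bX]

/-- **Hoeffding–Bentkus extremality (finitary convex order).** -/
theorem Ssum_le_bernoulli (w X : Fin N → ℝ) (hw : ∀ i, 0 ≤ w i) (hw1 : ∑ i, w i = 1)
    (hX : ∀ i, X i ∈ Set.Icc (0 : ℝ) 1) (k : ℕ) :
    ∀ φ : ℝ → ℝ, ConvexOn ℝ Set.univ φ →
      Ssum k w X φ ≤ Ssum k (bw (∑ i, w i * X i)) bX φ := by
  set p : ℝ := ∑ i, w i * X i with hp
  have hp0 : 0 ≤ p := Finset.sum_nonneg fun i _ => mul_nonneg (hw i) (hX i).1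
  have hp1 : p ≤ 1 := by
    calc p ≤ ∑ i, w i * 1 := Finset.sum_le_sum fun i _ => mul_le_mul_of_nonneg_left (hX i).2 (hw i)
      _ = 1 := by simp [hw1]
  have hbw : ∀ i, 0 ≤ bw p i := by
    intro i; fin_cases i <;> simp [bw, hp0, hp1]
  induction k with
  | zero => intro φ _; simp [Ssum_zero]
  | succ k ih =>
    intro φ hφ
    -- convexity of the translates
    have hφt : ∀ c : ℝ, ConvexOn ℝ Set.univ (fun s => φ (c + s)) := by
      intro c
      refine ⟨convex_univ, ?_⟩
      intro x _ y _ a b ha hb hab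
      have h := hφ.2 (Set.mem_univ (c + x)) (Set.mem_univ (c + y)) ha hb hab
      have heq : a • (c + x) + b • (c + y) = c + (a • x + b • y) := by
        simp only [smul_eq_mul]
        rw [show a * (c + x) + b * (c + y) = (a + b) * c + (a * x + b * y) by ring, hab, one_mul]
      rw [heq] at h
      exact h
    calc Ssum (k + 1) w X φ
        = ∑ i, w i * Ssum k w X (fun s => φ (X i + s)) := Ssum_succ k w X φ
      _ ≤ ∑ i, w i * Ssum k (bw p) bX (fun s => φ (X i + s)) :=
          Finset.sum_le_sum fun i _ => mul_le_mul_of_nonneg_left (ih _ (hφt (X i))) (hw i)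
      _ = Ssum k (bw p) bX (fun s => ∑ i, w i * φ (X i + s)) := by
          rw [Ssum_finset_sum]
          refine Finset.sum_congr rfl fun i _ => ?_
          rw [Ssum_smul]
      _ ≤ Ssum k (bw p) bX (fun s => (1 - p) * φ s + p * φ (1 + s)) := by
          refine Ssum_mono hbw fun ω => ?_
          set s : ℝ := ∑ r, bX (ω r)
          calc ∑ i, w i * φ (X i + s)
              ≤ ∑ i, w i * ((1 - X i) * φ s + X i * φ (1 + s)) :=
                Finset.sum_le_sum fun i _ =>
                  mul_le_mul_of_nonneg_left (chord hφ (hX i).1 (hX i).2 s) (hw i)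
            _ = (∑ i, w i) * φ s - (∑ i, w i * X i) * φ s + (∑ i, w i * X i) * φ (1 + s) := by
                simp only [Finset.sum_mul, ← Finset.sum_sub_distrib, ← Finset.sum_add_distrib]
                refine Finset.sum_congr rfl fun i _ => ?_
                ring
            _ = (1 - p) * φ s + p * φ (1 + s) := by rw [hw1, ← hp]; ring
      _ = (1 - p) * Ssum k (bw p) bX φ + p * Ssum k (bw p) bX (fun s => φ (1 + s)) := by
          rw [Ssum_add, Ssum_smul, Ssum_smul]
      _ = Ssum (k + 1) (bw p) bX φ := (Ssum_bernoulli_succ k p φ).symm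

/-- The hockey stick `x ↦ max (c - x) 0` is convex. -/
theorem convexOn_hockey (c : ℝ) : ConvexOn ℝ Set.univ (fun x : ℝ => max (c - x) 0) := by
  have h1 : ConvexOn ℝ Set.univ (fun x : ℝ => c - x) := by
    refine ⟨convex_univ, ?_⟩
    intro x _ y _ a b _ _ hab
    simp only [smul_eq_mul]
    have : a * (c - x) + b * (c - y) = (a + b) * c - (a * x + b * y) := by ring
    rw [this, hab, one_mul]
  have h2 : ConvexOn ℝ Set.univ (fun _ : ℝ => (0 : ℝ)) := convexOn_const 0 convex_univ
  exact h1.sup h2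

/-- Hockey stick at level `c`. -/
noncomputable def hockey (c : ℝ) : ℝ → ℝ := fun s => max (c - s) 0

theorem bX_nonneg (j : Fin 2) : 0 ≤ bX j := by
  fin_cases j <;> simp [bX]

theorem sum_bX_nonneg {k : ℕ} (ω : Fin k → Fin 2) : 0 ≤ ∑ r, bX (ω r) :=
  Finset.sum_nonneg fun r _ => bX_nonneg _

theorem bern_hockey_nonpos (k : ℕ) (p : ℝ) {c : ℝ} (hc : c ≤ 0) :
    Ssum k (bw p) bX (hockey c) = 0 := by
  have : Ssum k (bw p) bX (hockey c) = Ssum k (bw p) bX (fun _ => 0) :=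
    Ssum_congr fun ω => by
      have hs := sum_bX_nonneg ω
      simp only [hockey]
      exact max_eq_right (by linarith)
  rw [this]
  simp [Ssum]

theorem bern_hockey_shift (k : ℕ) (p c : ℝ) :
    Ssum k (bw p) bX (fun s => hockey c (1 + s)) = Ssum k (bw p) bX (hockey (c - 1)) :=
  Ssum_congr fun ω => by simp only [hockey]; ring_nf

theorem bern_hockey_one (k : ℕ) (p : ℝ) : Ssum k (bw p) bX (hockey 1) = (1 - p) ^ k := by
  induction k with
  | zero => simp [Ssum_zero, hockey]
  | succ k ih =>
    rw [Ssum_bernoulli_succ, bern_hockey_shift, ih, show (1 : ℝ) - 1 = 0 by norm_num,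
      bern_hockey_nonpos k p le_rfl]
    ring

theorem bern_hockey_two (k : ℕ) (p : ℝ) :
    Ssum k (bw p) bX (hockey 2) = 2 * (1 - p) ^ k + k * p * (1 - p) ^ (k - 1) := by
  induction k with
  | zero => simp [Ssum_zero, hockey]
  | succ k ih =>
    rw [Ssum_bernoulli_succ, bern_hockey_shift, ih, show (2 : ℝ) - 1 = 1 by norm_num,
      bern_hockey_one]
    cases k with
    | zero => simp; ring
    | succ j =>
      simp only [Nat.add_sub_cancel, pow_succ]
      push_cast
      ring

/-- **Card 1's first lemma, proved**: `P[∑_{r<k} X_{ω r} < 1] ≤ 2(1-p)^k + k p (1-p)^(k-1)`. -/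
theorem dartGameSmallBall (k N : ℕ) (w X : Fin N → ℝ) (hw : ∀ i, 0 ≤ w i) (hw1 : ∑ i, w i = 1)
    (hX : ∀ i, X i ∈ Set.Icc (0 : ℝ) 1) :
    ∑ ω ∈ (univ : Finset (Fin k → Fin N)).filter (fun ω => ∑ r, X (ω r) < 1), ∏ r, w (ω r) ≤
      2 * (1 - ∑ i, w i * X i) ^ k + k * (∑ i, w i * X i) * (1 - ∑ i, w i * X i) ^ (k - 1) := by
  -- step 1: the indicator of `{s < 1}` lies below the hockey stick at level 2
  have h1 : ∑ ω ∈ (univ : Finset (Fin k → Fin N)).filter (fun ω => ∑ r, X (ω r) < 1), ∏ r, w (ω r)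
      ≤ Ssum k w X (hockey 2) := by
    unfold Ssum
    rw [Finset.sum_filter]
    refine Finset.sum_le_sum fun ω _ => ?_
    have hprod : 0 ≤ ∏ r, w (ω r) := Finset.prod_nonneg fun r _ => hw _
    split_ifs with hlt
    · have hm : (1 : ℝ) ≤ hockey 2 (∑ r, X (ω r)) := by
        simp only [hockey]
        exact le_max_of_le_left (by linarith)
      nlinarith
    · exact mul_nonneg hprod (by simp only [hockey]; exact le_max_right _ _)
  -- step 2: binomial extremality in convex order
  have h2 := Ssum_le_bernoulli w X hw hw1 hX k (hockey 2) (convexOn_hockey 2)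
  -- step 3: evaluate the Bernoulli side
  have h3 := bern_hockey_two k (∑ i, w i * X i)
  linarith

end Summit.PneNP.PneNP.Cruxes.NoStableSection.SketchIdeator1

namespace Summit.PneNP.PneNP.Cruxes.NoStableSection.SketchIdeator1

/-- The ∀-closed form, syntactically the body of `DartGameSmallBall : Prop` in the folder's
`Sketch.lean` (card binomial-extremal-dart-game, First lemma) — hence that Prop HOLDS. -/
theorem dartGameSmallBall_closed :
    ∀ (k N : ℕ) (w X : Fin N → ℝ), (∀ i, 0 ≤ w i) → ∑ i, w i = 1 →
      (∀ i, X i ∈ Set.Icc (0 : ℝ) 1) →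
      ∑ ω ∈ (Finset.univ : Finset (Fin k → Fin N)).filter (fun ω => ∑ r, X (ω r) < 1), ∏ r, w (ω r) ≤
        2 * (1 - ∑ i, w i * X i) ^ k + k * (∑ i, w i * X i) * (1 - ∑ i, w i * X i) ^ (k - 1) :=
  fun k N w X hw hw1 hX => dartGameSmallBall k N w X hw hw1 hX

/-- The general extremality statement in the shape of `BinomialConvexDomination` restricted to the
Bernoulli product form (the binomial closed form is `bern_hockey_two`-style bookkeeping away). -/
theorem binomialConvexDomination_productForm (k N : ℕ) (w X : Fin N → ℝ) (φ : ℝ → ℝ)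
    (hw : ∀ i, 0 ≤ w i) (hw1 : ∑ i, w i = 1) (hX : ∀ i, X i ∈ Set.Icc (0 : ℝ) 1)
    (hφ : ConvexOn ℝ Set.univ φ) :
    Ssum k w X φ ≤ Ssum k (bw (∑ i, w i * X i)) bX φ :=
  Ssum_le_bernoulli w X hw hw1 hX k φ hφ

end Summit.PneNP.PneNP.Cruxes.NoStableSection.SketchIdeator1
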